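import Summits.BirchSwinnertonDyer.BirchSwinnertonDyer.Theorems.EisensteinPrimesMazurMCOnCellBKummerCharacterSupply
import Summits.BirchSwinnertonDyer.BirchSwinnertonDyer.Theorems.EisensteinPrimesMazurMCOnCellBKummerCharacterCountStackedRat
import HarnessLib

/-!
# The KUMMER-PRIME-FAMILY certificate: `t` Kummer primes of `E` with residue checks give
# `λ(X(E/ℚ_∞)) ≥ #S + t − 1` at the étale end
# (route `EisensteinPrimes`, crux 3 `MazurMCOnCellB` = stmt-BirchSwinnertonDyer-19033, line `mudescent`,
# stub 4″ `stub_lambdaCountWeak_offLocus`, ALGEBRAIC half; width seat bsd-line-x2-p1-w3, D-0154 row 5)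

HONEST FRAMING (cell `bsd-eis`; nothing here proves BSD or a main conjecture; 0 cells move): THEOREMS
ONLY — no definition, no named fact, nothing asserted about any particular curve, closes nothing. Sequel of
the one-prime certificate `…KummerPrimeCertificate`: the stacked socket (p633408) fed with
`V = ⟨χ_{ℓ_1}, …, χ_{ℓ_t}⟩ ≅ (ℤ/p)^t` for `t` DISTINCT Kummer primes `ℓ_i` of `E`.

* §1 (any topological group) `finset_prod_apply`, `character_pow_p`, `exists_prodHom` (the hom
  `(ℤ/p)^t → characters`, `a ↦ ∏ χ_i^{a_i}`), `prodHom_injective` (INDEPENDENCE: if elements `τ_j`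
  detect `χ_j` — `χ_j(τ_j) = 1 (mod p)` the generator — and kill `χ_i`, `i ≠ j`, the product hom is
  injective).
* §2 (over `ℚ`) `exists_mem_absInertia_apply_eq` — `χ_ℓ` takes EVERY value of `π₀` on the inertia group at
  `ℓ` (the cyclotomic character maps it onto `ℤ_ℓˣ`, tree `exists_mem_inertia_cyclotomicCharacter_eq`;
  unit lifting); `exists_apply_eq_of_ne_one` (a non-trivial hom onto a group of prime order is onto);
  **`X2.algebraicLambdaGE_of_kummerPrimes`** — `W/ℚ` globally minimal, `p` odd multiplicative with
  `p ∣ #E(ℚ)_tors`, `S` Tamagawa places, DISTINCT primes `ℓ_i` (`i < t`) with places `v_{ℓ_i} ∉ S ∪ {v_p}`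
  at which `E` is split multiplicative with `v(j)` not a `p`-th power (Kummer places), homs
  `π_i : (ℤ/ℓ_i)ˣ →* ℤ/p`, `π_i ≠ 1`, each killing `N v (mod ℓ_i)` for `v ∈ S ∪ {v_p}` and, jointly, for
  every bad `v ∉ S ∪ {v_p} ∪ {v_{ℓ_i}}` that is not itself a Kummer place; `μ_an ≤ m`; `hPT`, `h415`,
  `hWu`, `hpar`. Then **`AlgebraicLambdaGE W p (b − m)` for `p^{b + 2·v_p(#E(ℚ)_tors)} ≤ p^{#S+1} · p^t`**:
  at the étale end `λ(X(E/ℚ_∞)) ≥ #S + t − 1`. Independence of the `χ_{ℓ_i}`: `χ_{ℓ_i}` is unramified at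
  `ℓ_j ≠ ℓ_i` while `χ_{ℓ_j}` hits the generator on the inertia group at `ℓ_j`.

With `…KummerCharacterSupply.exists_unitsHom_of_dvd` (`p ∣ ℓ_i − 1`) every residue hypothesis is the
census integer check `q^{(ℓ_i−1)/p} ≡ 1 (mod ℓ_i)`, `q = N v`.
References: [GreenbergLNM1716] §5 proof of Prop. 5.10, pp. 114–118, p. 137; [SerreAbelianLadic1968] I §1.2;
[SerreLocalFields1979] IV §4 Prop. 17; [Wuthrich2014] Thm. 16.
-/

set_option autoImplicit false
-- `Summit.BirchSwinnertonDyer.BirchSwinnertonDyer.…`: the summit and its single sub-problem share a name (D-0017 layout).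
set_option linter.dupNamespace false

noncomputable section

open scoped Classical

open Function Field NumberField IsDedekindDomain WeierstrassCurve
  Literature.NumberTheory.EllipticCurves Literature.NumberTheory.GaloisRepresentations
  Literature.NumberTheory.GaloisCohomology
  Literature.NumberTheory.EllipticCurves.Rank1Residual Literature.NumberTheory.EllipticCurves.ModularForms
  Summit.BirchSwinnertonDyer.Rank1Residual
  Summit.BirchSwinnertonDyer.Rank1Residual.X1.GeneratorCountSqueeze
  Summit.BirchSwinnertonDyer.Rank1Residual.X1.TamagawaSqueeze
  Summit.BirchSwinnertonDyer.BirchSwinnertonDyer.Theorems.EisensteinPrimesMazurMCOnCellBKummerCharacterCountStackedRat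
  Summit.BirchSwinnertonDyer.BirchSwinnertonDyer.Theorems.EisensteinPrimesMazurMCOnCellBKummerCharacterSupply

namespace Summit.BirchSwinnertonDyer.BirchSwinnertonDyer.Theorems.EisensteinPrimesMazurMCOnCellBKummerPrimeFamilyCertificate

/-! ## §1. Products of characters: evaluation and independence -/

section Characters

variable {p : ℕ} [hp : Fact p.Prime]

/-- Evaluation of a finite product of continuous characters: `(∏ f_i)(σ) = ∏ f_i(σ)`. [folklore] -/
theorem finset_prod_apply {G : Type*} [Group G] [TopologicalSpace G] {ι : Type*} (s : Finset ι)
    (f : ι → (G →ₜ* Multiplicative (ZMod p))) (σ : G) :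
    (∏ i ∈ s, f i) σ = ∏ i ∈ s, f i σ := by
  induction s using Finset.cons_induction with
  | empty => rw [Finset.prod_empty, Finset.prod_empty, ContinuousMonoidHom.coe_one, Pi.one_apply]
  | cons a s ha ih => rw [Finset.prod_cons, Finset.prod_cons, ContinuousMonoidHom.mul_apply, ih]

/-- Every continuous character into `ℤ/p` is killed by `p`: `χ^p = 1`. [folklore] -/
theorem character_pow_p {G : Type*} [Group G] [TopologicalSpace G] (χ : G →ₜ* Multiplicative (ZMod p)) :
    χ ^ p = 1 := by
  ext σ
  rw [ContinuousMonoidHom.coe_one, Pi.one_apply]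
  simp only [ContinuousMonoidHom.pow_apply]
  rw [← ofAdd_toAdd (χ σ), ← ofAdd_nsmul, nsmul_eq_mul, ZMod.natCast_self, zero_mul, ofAdd_zero]

/-- **The product hom `(ℤ/p)^t →* characters`, `a ↦ ∏_i χ_i^{a_i}`** (well defined because `χ_i^p = 1`;
existence with its formula, no definition introduced). [folklore] -/
theorem exists_prodHom {G : Type*} [Group G] [TopologicalSpace G] {t : ℕ}
    (χ : Fin t → (G →ₜ* Multiplicative (ZMod p))) :
    ∃ F : (Fin t → Multiplicative (ZMod p)) →* (G →ₜ* Multiplicative (ZMod p)),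
      ∀ a, F a = ∏ i, χ i ^ (Multiplicative.toAdd (a i)).val := by
  haveI : NeZero p := ⟨hp.out.ne_zero⟩
  have hpow_val : ∀ (i : Fin t) (a c : ZMod p), χ i ^ (a + c).val = χ i ^ a.val * χ i ^ c.val :=
    fun i a c ↦ by rw [ZMod.val_add, ← pow_eq_pow_mod _ (character_pow_p (χ i)), pow_add]
  let F : (Fin t → Multiplicative (ZMod p)) →* (G →ₜ* Multiplicative (ZMod p)) :=
    { toFun := fun a ↦ ∏ i, χ i ^ (Multiplicative.toAdd (a i)).val
      map_one' := by
        simp only [Pi.one_apply, toAdd_one, ZMod.val_zero, pow_zero, Finset.prod_const_one]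
      map_mul' := fun a c ↦ by
        rw [← Finset.prod_mul_distrib]
        exact Finset.prod_congr rfl fun i _ ↦ by rw [Pi.mul_apply, toAdd_mul, hpow_val] }
  exact ⟨F, fun a ↦ rfl⟩

/-- **Independence.** If elements `τ_j` satisfy `χ_j(τ_j) = ofAdd 1` and `χ_i(τ_j) = 1` for `i ≠ j`, the
product hom `a ↦ ∏ χ_i^{a_i}` is injective (evaluate at `τ_j` to read off `a_j`). [folklore] -/
theorem prodHom_injective {G : Type*} [Group G] [TopologicalSpace G] {t : ℕ}
    (χ : Fin t → (G →ₜ* Multiplicative (ZMod p)))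
    (F : (Fin t → Multiplicative (ZMod p)) →* (G →ₜ* Multiplicative (ZMod p)))
    (hF : ∀ a, F a = ∏ i, χ i ^ (Multiplicative.toAdd (a i)).val)
    (τ : Fin t → G) (hτ : ∀ j, χ j (τ j) = Multiplicative.ofAdd 1)
    (hτ' : ∀ i j, i ≠ j → χ i (τ j) = 1) : Function.Injective F := by
  haveI : NeZero p := ⟨hp.out.ne_zero⟩
  have key : ∀ a j, F a (τ j) = a j := fun a j ↦ by
    rw [hF, finset_prod_apply, Finset.prod_eq_single j]
    · rw [ContinuousMonoidHom.pow_apply, hτ j, ← ofAdd_nsmul, nsmul_one, ZMod.natCast_zmod_val, ofAdd_toAdd]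
    · intro i _ hij
      rw [ContinuousMonoidHom.pow_apply, hτ' i j hij, one_pow]
    · intro h; exact absurd (Finset.mem_univ j) h
  intro a c h
  funext j
  rw [← key a j, ← key c j, h]

end Characters

/-! ## §2. Over `ℚ`: inertia witnesses for `χ_ℓ`, and the multi-Kummer-prime certificate -/

section Rat

variable {p : ℕ} [hp : Fact p.Prime]

/-- **Inertia witnesses for `χ_ℓ`**: for the character `χ = π₀ ∘ (χ_cyc,ℓ mod ℓ)` of `Γ_ℚ`
(`…KummerCharacterSupply`) and ANY unit `u₀` of `ℤ/ℓ` there is `τ` in the inertia group `absInertia ℚ_ℓ`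
with `χ(res τ) = π₀ u₀`: `u₀` lifts to `ℤ_ℓˣ` and the `ℓ`-adic cyclotomic character maps the inertia group
at `ℓ` ONTO `ℤ_ℓˣ` (tree `exists_mem_inertia_cyclotomicCharacter_eq`, `I_{𝔓₀} = res(absInertia)`).
[cite: SerreLocalFields1979, Ch. IV §4 Prop. 17] [cite: NeukirchANT1999, Ch. II §9 Prop. (9.6)] -/
theorem exists_mem_absInertia_apply_eq {ℓ : ℕ} [hℓ : Fact ℓ.Prime]
    (π₀ : (ZMod ℓ)ˣ →* Multiplicative (ZMod p)) (red : ℤ_[ℓ] →+* ZMod ℓ) (hred : ∀ n : ℕ, red n = n)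
    (χ : absoluteGaloisGroup ℚ →ₜ* Multiplicative (ZMod p))
    (hχ : ∀ σ, χ σ = π₀ (Units.map (red : ℤ_[ℓ] →* ZMod ℓ) (GaloisRep.cyclotomicCharacter ℚ ℓ σ)))
    (vℓ : HeightOneSpectrum (𝓞 ℚ)) (hvℓ : ((ℓ : ℕ) : 𝓞 ℚ) ∈ vℓ.asIdeal) (u₀ : (ZMod ℓ)ˣ) :
    ∃ τ ∈ absInertia (vℓ.adicCompletion ℚ), χ (resGal (K := ℚ) (vℓ.adicCompletion ℚ) τ) = π₀ u₀ := by
  -- lift `u₀` to a unit of `ℤ_ℓ`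
  set n : ℕ := (u₀ : ZMod ℓ).val with hn
  have hn0 : ¬ ℓ ∣ n := fun h ↦ by
    have h1 : ((n : ℕ) : ZMod ℓ) = 0 := (ZMod.natCast_eq_zero_iff n ℓ).mpr h
    rw [hn, ZMod.natCast_zmod_val] at h1
    exact u₀.ne_zero h1
  have hunit : IsUnit ((n : ℤ) : ℤ_[ℓ]) := by
    rw [PadicInt.isUnit_iff]
    refine le_antisymm (PadicInt.norm_le_one _) (not_lt.mp fun h ↦ hn0 ?_)
    exact Int.natCast_dvd_natCast.mp ((PadicInt.norm_int_lt_one_iff_dvd (p := ℓ) (n : ℤ)).mp h)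
  set t : ℤ_[ℓ]ˣ := hunit.unit with ht
  have hut : Units.map (red : ℤ_[ℓ] →* ZMod ℓ) t = u₀ := by
    ext
    rw [Units.coe_map, MonoidHom.coe_coe, ht, IsUnit.unit_spec, Int.cast_natCast, hred, hn,
      ZMod.natCast_zmod_val]
  have hvℓ' : (Rat.HeightOneSpectrum.primesEquiv vℓ : ℕ) = ℓ :=
    Rat.HeightOneSpectrum.primesEquiv_eq_of_natCast_mem vℓ hℓ.out hvℓ
  obtain ⟨τ, hτI, hτ⟩ := Literature.NumberTheory.EllipticCurves.exists_mem_inertia_cyclotomicCharacter_eq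
    ℓ hvℓ' (adicCompletionPrime_mem_primesAbove ℚ vℓ) t
  rw [inertia_adicCompletionPrime_eq_map_absInertia] at hτI
  obtain ⟨τ', hτ', rfl⟩ := Subgroup.mem_map.mp hτI
  refine ⟨τ', hτ', ?_⟩
  change χ (absGaloisRestrict ℚ (vℓ.adicCompletion ℚ) τ') = π₀ u₀
  rw [hχ, show ((absGaloisRestrict ℚ (vℓ.adicCompletion ℚ)).toMonoidHom τ') =
    absGaloisRestrict ℚ (vℓ.adicCompletion ℚ) τ' from rfl] at *
  rw [hτ, hut]

/-- A non-trivial hom into `Multiplicative (ZMod p)` (prime order) is onto. [folklore] -/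
theorem exists_apply_eq_of_ne_one {ℓ : ℕ} (π₀ : (ZMod ℓ)ˣ →* Multiplicative (ZMod p))
    (hπ₀ : ∃ u : (ZMod ℓ)ˣ, π₀ u ≠ 1) (c : Multiplicative (ZMod p)) : ∃ u : (ZMod ℓ)ˣ, π₀ u = c := by
  haveI : Fact (Nat.card (Multiplicative (ZMod p))).Prime :=
    ⟨by rw [Nat.card_congr Multiplicative.toAdd, Nat.card_zmod]; exact hp.out⟩
  rcases π₀.range.eq_bot_or_eq_top_of_prime_card with h | h
  · obtain ⟨u, hu⟩ := hπ₀
    exact absurd ((Subgroup.eq_bot_iff_forall _).mp h (π₀ u) ⟨u, rfl⟩) hu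
  · have hc : c ∈ π₀.range := by rw [h]; exact Subgroup.mem_top c
    exact MonoidHom.mem_range.mp hc

/-- **The KUMMER-PRIME-FAMILY CERTIFICATE.** `W/ℚ` globally minimal, `p` odd of multiplicative reduction
with `p ∣ #E(ℚ)_tors`; `S` Tamagawa places (`v ∤ p`, `p ∣ c_v`); distinct primes `ℓ_i` (`i : Fin t`) with
places `v_{ℓ_i} ∉ S`, `v_{ℓ_i} ∤ p`, at which `E` is split multiplicative with `v(j)` not a `p`-th power;
homs `π_i : (ℤ/ℓ_i)ˣ →* ℤ/p`, `π_i ≠ 1`, killing `N v (mod ℓ_i)` for every `v ∈ S ∪ {v_p}` (`hres`) and,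
for every bad `v ∉ S ∪ {v_p}` off the `v_{ℓ_i}`, either all `π_i` kill `N v (mod ℓ_i)` or `v` is itself a
Kummer place (`hbad`); the certificate `μ_an ≤ m`; named facts `hPT`, `h415`, `hWu`, `hpar` as in lam-b's
socket. Then **`AlgebraicLambdaGE W p (b − m)` whenever `p^{b + 2·v_p(#E(ℚ)_tors)} ≤ p^{#S+1} · p^t`**
(the stacked socket p633408 with `V = ⟨χ_{ℓ_i}⟩ ≅ (ℤ/p)^t`, independence by the inertia witnesses). At
the étale end of a type-A class (`m = 0`, `v_p(#E(ℚ)_tors) = 1`): `λ(X(E/ℚ_∞)) ≥ #S + t − 1`.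
[cite: GreenbergLNM1716, §5 proof of Prop. 5.10, pp. 114–118, p. 137] [cite: Wuthrich2014, Thm. 16 (p. 397)] -/
theorem X2.algebraicLambdaGE_of_kummerPrimes {W : WeierstrassCurve ℚ} [W.IsElliptic] [W.IsGloballyMinimal]
    (hodd : p ≠ 2) (hPT : poitouTate_selmerStructure_duality ℚ)
    (h415 : Greenberg1999.prop415ii_noFiniteSubmodule_of_ordinary_or_multiplicative)
    (hWu : Wuthrich2014.thm16_charIdeal_dvd_multiplicative_of_reducible)
    (hpar : nonempty_modularParametrizationData)
    (hmult : W.HasMultiplicativeReductionAtPrime p) (htors : p ∣ W.torsionOrder)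
    (S : Finset (HeightOneSpectrum (𝓞 ℚ))) (hSp : ∀ v ∈ S, ((p : ℕ) : 𝓞 ℚ) ∉ v.asIdeal)
    (hcv : ∀ v ∈ S,
      p ∣ (W.baseChange (v.adicCompletion ℚ)).localTamagawaNumber (v.adicCompletionIntegers ℚ))
    {t : ℕ} (ℓ : Fin t → ℕ) [hℓ : ∀ i, Fact (ℓ i).Prime] (hℓinj : Function.Injective ℓ)
    (π : ∀ i, (ZMod (ℓ i))ˣ →* Multiplicative (ZMod p)) (hπ : ∀ i, ∃ u : (ZMod (ℓ i))ˣ, π i u ≠ 1)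
    (vℓ : Fin t → HeightOneSpectrum (𝓞 ℚ)) (hvℓ : ∀ i, ((ℓ i : ℕ) : 𝓞 ℚ) ∈ (vℓ i).asIdeal)
    (hℓS : ∀ i, vℓ i ∉ S) (hℓp : ∀ i, ((p : ℕ) : 𝓞 ℚ) ∉ (vℓ i).asIdeal)
    (hKum : ∀ i, W.HasSplitMultiplicativeReductionAt (vℓ i) ∧ ∀ x : (vℓ i).adicCompletion ℚ,
      Valued.v (algebraMap ℚ ((vℓ i).adicCompletion ℚ) W.j) ≠ Valued.v x ^ p)
    (hres : ∀ i, ∀ v : HeightOneSpectrum (𝓞 ℚ), (v ∈ S ∨ ((p : ℕ) : 𝓞 ℚ) ∈ v.asIdeal) →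
      ∀ u : (ZMod (ℓ i))ˣ, (u : ZMod (ℓ i)) = (v.residueCard : ZMod (ℓ i)) → π i u = 1)
    (hbad : ∀ v : HeightOneSpectrum (𝓞 ℚ), v ∉ S → ((p : ℕ) : 𝓞 ℚ) ∉ v.asIdeal →
      (∀ i, ((ℓ i : ℕ) : 𝓞 ℚ) ∉ v.asIdeal) → ¬ W.HasGoodReductionAt v →
      (∀ i, ∀ u : (ZMod (ℓ i))ˣ, (u : ZMod (ℓ i)) = (v.residueCard : ZMod (ℓ i)) → π i u = 1) ∨
      (W.HasSplitMultiplicativeReductionAt v ∧ ∀ x : v.adicCompletion ℚ,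
        Valued.v (algebraMap ℚ (v.adicCompletion ℚ) W.j) ≠ Valued.v x ^ p))
    {m : ℕ} (hμ : X2.AnalyticMuLE W p m)
    {b : ℕ} (hb : p ^ (b + 2 * (W.torsionOrder).factorization p) ≤ p ^ (S.card + 1) * p ^ t) :
    AlgebraicLambdaGE W p (b - m) := by
  haveI : NeZero p := ⟨hp.out.ne_zero⟩
  -- the Kummer characters of the `ℓ_i`
  choose red χ hred hχ using fun i ↦ exists_character_of_cyclotomicCharacter ℚ (ℓ i) (π i)
  -- places: `ℓ_i ∉ v` off `v_{ℓ_i}`; `ℓ_i ∉ v_{ℓ_j}` for `i ≠ j`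
  have hℓ_off : ∀ i (v : HeightOneSpectrum (𝓞 ℚ)), v ≠ vℓ i → ((ℓ i : ℕ) : 𝓞 ℚ) ∉ v.asIdeal :=
    fun i v hv h ↦ hv (((natCast_mem_asIdeal_iff_eq_primesEquiv_symm v (hℓ i).out).mp h).trans
      ((natCast_mem_asIdeal_iff_eq_primesEquiv_symm (vℓ i) (hℓ i).out).mp (hvℓ i)).symm)
  have hvℓinj : ∀ i j, vℓ i = vℓ j → i = j := fun i j h ↦ hℓinj (by
    have hi := (natCast_mem_asIdeal_iff_eq_primesEquiv_symm (vℓ i) (hℓ i).out).mp (hvℓ i)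
    have hj := (natCast_mem_asIdeal_iff_eq_primesEquiv_symm (vℓ j) (hℓ j).out).mp (hvℓ j)
    rw [h] at hi
    have := (Rat.HeightOneSpectrum.primesEquiv (R := 𝓞 ℚ)).symm.injective (hi.symm.trans hj)
    exact congrArg Subtype.val this)
  -- inertia witnesses and independence
  have hτ : ∀ j, ∃ τ ∈ absInertia ((vℓ j).adicCompletion ℚ),
      χ j (resGal (K := ℚ) ((vℓ j).adicCompletion ℚ) τ) = Multiplicative.ofAdd 1 := fun j ↦ by
    obtain ⟨u₀, hu₀⟩ := exists_apply_eq_of_ne_one (π j) (hπ j) (Multiplicative.ofAdd 1)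
    obtain ⟨τ, hτ, h⟩ := exists_mem_absInertia_apply_eq (π j) (red j) (hred j) (χ j) (hχ j) (vℓ j) (hvℓ j) u₀
    exact ⟨τ, hτ, h.trans hu₀⟩
  choose τ hτI hτ1 using hτ
  obtain ⟨F, hF⟩ := exists_prodHom χ
  have hFinj : Function.Injective F :=
    prodHom_injective χ F hF (fun j ↦ resGal (K := ℚ) ((vℓ j).adicCompletion ℚ) (τ j)) hτ1
      (fun i j hij ↦ character_eq_one_of_mem_absInertia (π i) (red i) (χ i) (hχ i)
        (hℓ_off i (vℓ j) (fun h ↦ hij (hvℓinj i j h.symm))) (hτI j))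
  let V : Subgroup (absoluteGaloisGroup ℚ →ₜ* Multiplicative (ZMod p)) := F.range
  haveI : Finite V := Finite.of_surjective _ (MonoidHom.rangeRestrict_surjective F)
  have hVcard : Nat.card V = p ^ t := by
    rw [← Nat.card_congr (MonoidHom.ofInjective hFinj).toEquiv, Nat.card_pi, Finset.prod_const,
      Finset.card_univ, Fintype.card_fin, Nat.card_congr Multiplicative.toAdd, Nat.card_zmod]
  have hVmem : ∀ ψ ∈ V, ∃ n : Fin t → ℕ, ψ = ∏ i, χ i ^ n i := fun ψ hψ ↦ by
    obtain ⟨a, rfl⟩ := MonoidHom.mem_range.mp hψ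
    exact ⟨fun i ↦ (Multiplicative.toAdd (a i)).val, hF a⟩
  -- local behaviour of the products
  have htriv : ∀ v : HeightOneSpectrum (𝓞 ℚ), (∀ i, ((ℓ i : ℕ) : 𝓞 ℚ) ∉ v.asIdeal) →
      (∀ i, ∀ u : (ZMod (ℓ i))ˣ, (u : ZMod (ℓ i)) = (v.residueCard : ZMod (ℓ i)) → π i u = 1) →
      ∀ ψ ∈ V, ∀ σ : absoluteGaloisGroup (v.adicCompletion ℚ),
        ψ (resGal (K := ℚ) (v.adicCompletion ℚ) σ) = 1 := by
    intro v hℓv hπv ψ hψ σ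
    obtain ⟨n, rfl⟩ := hVmem ψ hψ
    rw [finset_prod_apply]
    exact Finset.prod_eq_one fun i _ ↦ by
      rw [ContinuousMonoidHom.pow_apply,
        character_eq_one_of_residueCard (π i) (red i) (hred i) (χ i) (hχ i) (hℓv i) (hπv i) σ, one_pow]
  have hunr : ∀ v : HeightOneSpectrum (𝓞 ℚ), (∀ i, ((ℓ i : ℕ) : 𝓞 ℚ) ∉ v.asIdeal) →
      ∀ ψ ∈ V, ∀ τ ∈ absInertia (v.adicCompletion ℚ), ψ (resGal (K := ℚ) (v.adicCompletion ℚ) τ) = 1 := by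
    intro v hℓv ψ hψ τ hτ
    obtain ⟨n, rfl⟩ := hVmem ψ hψ
    rw [finset_prod_apply]
    exact Finset.prod_eq_one fun i _ ↦ by
      rw [ContinuousMonoidHom.pow_apply, character_eq_one_of_mem_absInertia (π i) (red i) (χ i) (hχ i) (hℓv i) hτ,
        one_pow]
  have hℓ_of : ∀ v : HeightOneSpectrum (𝓞 ℚ), (v ∈ S ∨ ((p : ℕ) : 𝓞 ℚ) ∈ v.asIdeal) →
      ∀ i, ((ℓ i : ℕ) : 𝓞 ℚ) ∉ v.asIdeal := by
    intro v hv i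
    refine hℓ_off i v fun h ↦ ?_
    subst h
    rcases hv with hv | hv
    · exact hℓS i hv
    · exact hℓp i hv
  refine X2.algebraicLambdaGE_of_kummerCharacters_stacked_of_dvd_torsionOrder hodd hPT h415 hWu hpar hmult
    htors S hSp hcv V (fun ψ hψ v hv σ ↦ htriv v (hℓ_of v hv) (hres · v hv) ψ hψ σ) (fun ψ hψ v hvS hvp ↦ ?_)
    hμ (by rw [hVcard]; exact hb)
  by_cases hvℓ' : ∃ i, ((ℓ i : ℕ) : 𝓞 ℚ) ∈ v.asIdeal
  · -- `v = v_{ℓ_i}`: a Kummer place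
    obtain ⟨i, hi⟩ := hvℓ'
    have hveq : v = vℓ i := ((natCast_mem_asIdeal_iff_eq_primesEquiv_symm v (hℓ i).out).mp hi).trans
      ((natCast_mem_asIdeal_iff_eq_primesEquiv_symm (vℓ i) (hℓ i).out).mp (hvℓ i)).symm
    subst hveq
    exact Or.inr (Or.inr (hKum i))
  · push Not at hvℓ'
    by_cases hgood : W.HasGoodReductionAt v
    · exact Or.inl ⟨hgood, hunr v hvℓ' ψ hψ⟩
    · rcases hbad v hvS hvp hvℓ' hgood with hπv | hK
      · exact Or.inr (Or.inl (htriv v hvℓ' hπv ψ hψ))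
      · exact Or.inr (Or.inr hK)

end Rat


end Summit.BirchSwinnertonDyer.BirchSwinnertonDyer.Theorems.EisensteinPrimesMazurMCOnCellBKummerPrimeFamilyCertificate

end
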